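import Literature.NumberTheory.Irrationality.Hata1993.IrrationalityMeasureCore
import HarnessLib

/-!
# Rhin–Viola 1996, Lemma 4.3: an irrationality measure from linear forms with an EXACT error rate

Topic `Literature/NumberTheory/Irrationality/RhinViola1996`. Typed-and-PROVED (no definition, no named fact; cell
`zeta5-irr`, seat zi-lit g17) from G. Rhin, C. Viola, *On a permutation group related to ζ(2)*, Acta Arith. **77**
(1996) 23–56 [RhinViola1996], §4 p. 51 (held text `paper:doi-10-4064-aa-77-1-23-56`, p0029 read on the page):

> "In order to get from this an irrationality measure of `ζ(2)`, we recall the following well-known lemma (see [8],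
> Lemma 4): **Lemma 4.3.** Let `α ∈ ℝ`, and let `(rₙ)`, `(sₙ)` be sequences of integers satisfying
> `lim (1/n) log|rₙ − sₙα| = −R` and `limsup (1/n) log|sₙ| ≤ S` for some positive numbers `R` and `S`. Then
> `μ(α) ≤ S/R + 1`."

(`[8]` = G. Rhin, C. Viola, *On the irrationality measure of ζ(2)*, Ann. Inst. Fourier **43** (1993) 85–109, Lemma 4;
p. 23 of the source: "`λ` is an irrationality measure of the irrational number `α` if for any `ε > 0` there exists a
constant `q₀ = q₀(ε) > 0` such that `|α − p/q| > q^{−λ−ε}` for all integers `p` and `q` with `q > q₀`. We denote by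
`μ(α)` the minimum of" such `λ`.) This is the closing device of Rhin–Viola 2001, Theorem 5.1 ("From (5.14), (5.18),
(5.19) and Lemma 4.3 of [4] we obtain …", [4] = this paper), DIFFERENT from the tree's Hata 1993 Remark 2.1
(`Hata1993.remark_2_1`: there the COEFFICIENTS `qₙ` have an exact rate and the error only an upper rate; here the
ERROR `rₙ − sₙα` has an exact rate and the coefficients `sₙ` only an upper rate — no lower bound on `|sₙ|` and no
non-vanishing hypothesis is needed, the case `q rₙ = p sₙ` being settled by the lower error rate).

Rendering: "`μ(α) ≤ λ`" is the tree's `Hata1993.HasIrrationalityMeasure α λ` (`|α − p/q| ≥ q^{−λ−ε}` for `q ≥ q₀(ε)`;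
equivalent to the source's strict version since `ε > 0` is arbitrary), with the bridge
`HasIrrationalityMeasure.not_liouvilleWith` to Mathlib's `LiouvilleWith`. The two limit hypotheses are typed in the
unfolded `ε–N` form used by the proof (`lemma43_of_rates`: for every `δ > 0`, eventually
`e^{−(R+δ)n} ≤ |rₙ − sₙα| ≤ e^{−(R−δ)n}` and `|sₙ| ≤ e^{(S+δ)n}`), and in the literal form (`lemma43`: `Tendsto` of
`(1/n) log|rₙ − sₙα|` to `−R`, and "`(1/n) log|sₙ| ≤ S + δ` for all large `n`" for every `δ > 0`, which is what
`limsup ≤ S` means).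

Proof (the standard one, not printed in the source): given `ε`, choose `δ` with `(S+3δ)/(R−δ) ≤ S/R + ε/2` (the tree's
`Hata1993.exists_delta`), then for `q` large let `n = ⌈log(2q)/(R−δ)⌉`, so that `q|rₙ − sₙα| ≤ 1/2` and
`e^{−an} ≥ e^{−a}(2q)^{−a/(R−δ)}`; if `q rₙ ≠ p sₙ` then `1 ≤ |q rₙ − p sₙ| ≤ 1/2 + |sₙ||qα − p|`, if `q rₙ = p sₙ` then
`|sₙ||qα − p| = q|rₙ − sₙα| ≥ q e^{−(R+δ)n}`; in both cases `|qα − p| ≥ C(δ) q^{−(S+3δ)/(R−δ)}`.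

HONEST FRAMING (cells pub-zeta5 / zeta5-irr): a 1993/1996 lemma as printed; no measure of any constant is asserted here;
records in print unmoved; nothing about `ζ(5)`.
-/

noncomputable section

open Filter Real Topology

namespace Literature.NumberTheory.Irrationality.RhinViola1996

open Hata1993 (HasIrrationalityMeasure exists_delta)

/-- **Lemma 4.3 (rates form).** `α ∈ ℝ`, integers `rₙ, sₙ` with, for every `δ > 0` and all large `n`,
`e^{−(R+δ)n} ≤ |rₙ − sₙα| ≤ e^{−(R−δ)n}` and `|sₙ| ≤ e^{(S+δ)n}` (`R, S > 0`): then `μ(α) ≤ S/R + 1`.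
[cite: RhinViola1996, Lemma 4.3 (p. 51)] -/
theorem lemma43_of_rates {α R S : ℝ} (hR : 0 < R) (hS : 0 < S) (r s : ℕ → ℤ)
    (herr : ∀ δ : ℝ, 0 < δ → ∀ᶠ n : ℕ in atTop,
      Real.exp (-((R + δ) * n)) ≤ |(r n : ℝ) - s n * α| ∧
        |(r n : ℝ) - s n * α| ≤ Real.exp (-((R - δ) * n)))
    (hs : ∀ δ : ℝ, 0 < δ → ∀ᶠ n : ℕ in atTop, |(s n : ℝ)| ≤ Real.exp ((S + δ) * n)) :
    HasIrrationalityMeasure α (S / R + 1) := by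
  intro ε hε
  obtain ⟨δ', hδ'pos, hδ'R, hδ'slope⟩ := exists_delta hS hR hε
  obtain ⟨δ, hδ_def⟩ : ∃ δ : ℝ, δ = δ' / 3 := ⟨_, rfl⟩
  have hδpos : 0 < δ := by rw [hδ_def]; positivity
  have hc : 0 < R - δ := by rw [hδ_def]; linarith
  -- eventual hypotheses at this `δ`
  obtain ⟨N, hN⟩ := eventually_atTop.1 ((herr δ hδpos).and (hs δ hδpos))
  -- the exponent produced by the argument, and its comparison with `S/R + ε/2`
  set lam : ℝ := (S + 3 * δ) / (R - δ) with hlam_def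
  have hlam_pos : 0 < lam := by positivity
  set κ : ℝ := S / R + ε / 2 with hκ_def
  have hlamκ : lam ≤ κ := by
    have h3 : 0 < R - 3 * δ' := by linarith
    have h1 : lam = (S + δ') / (R - δ' / 3) := by
      rw [hlam_def, hδ_def]; ring_nf
    rw [h1]
    calc (S + δ') / (R - δ' / 3) ≤ (S + δ') / (R - 3 * δ') :=
          div_le_div_of_nonneg_left (by linarith) h3 (by linarith)
      _ ≤ κ := hδ'slope
  -- the constant `C₀ = ½ e^{−(R+S+2δ)} 2^{−λ}`
  set C₀ : ℝ := 1 / 2 * Real.exp (-(R + S + 2 * δ)) * (2 : ℝ) ^ (-lam) with hC₀_def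
  have hC₀ : 0 < C₀ := by positivity
  -- `q₀`: large enough for `n(q) ≥ N` and for `q^{−ε/2} ≤ C₀`
  set B : ℝ := max (C₀ ^ (-(2 / ε))) (Real.exp ((R - δ) * N) / 2) with hB_def
  obtain ⟨q₀, hq₀⟩ : ∃ q₀ : ℕ, B ≤ q₀ := exists_nat_ge B
  refine ⟨q₀ + 1, Nat.succ_pos _, fun p q hq => ?_⟩
  have hqB : B < (q : ℝ) := by
    have h1 : ((q₀ + 1 : ℕ) : ℤ) ≤ q := hq
    have h2 : ((q₀ : ℝ) + 1) ≤ (q : ℝ) := by exact_mod_cast h1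
    linarith
  have hq1 : (1 : ℝ) ≤ q := by
    have h1 : ((q₀ + 1 : ℕ) : ℤ) ≤ q := hq
    exact_mod_cast (show (1 : ℤ) ≤ q by omega)
  have hqpos : (0 : ℝ) < q := by linarith
  have h2q : (1 : ℝ) < 2 * q := by linarith
  have h2qpos : (0 : ℝ) < 2 * q := by linarith
  have hlogpos : 0 < Real.log (2 * q) := Real.log_pos h2q
  -- the index `n = ⌈log(2q)/(R−δ)⌉`
  set L : ℝ := Real.log (2 * q) / (R - δ) with hL_def
  have hLpos : 0 ≤ L := by positivity
  set n : ℕ := ⌈L⌉₊ with hn_def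
  have hLn : L ≤ n := Nat.le_ceil L
  have hnL : (n : ℝ) < L + 1 := Nat.ceil_lt_add_one hLpos
  have hNn : N ≤ n := by
    have h1 : Real.exp ((R - δ) * N) < 2 * q := by
      have : Real.exp ((R - δ) * N) / 2 ≤ B := le_max_right _ _
      linarith
    have h2 : (R - δ) * N < Real.log (2 * q) := by
      rw [← Real.log_exp ((R - δ) * N)]
      exact Real.log_lt_log (Real.exp_pos _) h1
    have h3 : (N : ℝ) < L := by
      rw [hL_def, lt_div_iff₀ hc]; linarith
    exact_mod_cast (h3.le.trans hLn)
  obtain ⟨⟨he1, he2⟩, hsn⟩ := hN n hNn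
  -- `e^{−a}(2q)^{−a/(R−δ)} ≤ e^{−an}` for `a > 0` (from `n < L + 1`)
  have key : ∀ a : ℝ, 0 < a →
      Real.exp (-a) * (2 * (q : ℝ)) ^ (-(a / (R - δ))) ≤ Real.exp (-(a * n)) := by
    intro a ha
    rw [Real.rpow_def_of_pos h2qpos, ← Real.exp_add]
    apply Real.exp_le_exp.2
    have : Real.log (2 * q) * (-(a / (R - δ))) = -(a * L) := by
      rw [hL_def]; field_simp
    rw [this]
    nlinarith [hnL, ha]
  -- (i) `q e^{−(R−δ)n} ≤ 1/2`
  have hi : (q : ℝ) * Real.exp (-((R - δ) * n)) ≤ 1 / 2 := by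
    have h1 : Real.log (2 * q) ≤ (R - δ) * n := by
      have := hLn; rw [hL_def, div_le_iff₀ hc] at this; linarith
    have h2 : Real.exp (-((R - δ) * n)) ≤ Real.exp (-Real.log (2 * q)) :=
      Real.exp_le_exp.2 (by linarith)
    rw [Real.exp_neg (Real.log (2 * q)), Real.exp_log h2qpos] at h2
    calc (q : ℝ) * Real.exp (-((R - δ) * n)) ≤ (q : ℝ) * (2 * (q : ℝ))⁻¹ := by gcongr
      _ = 1 / 2 := by field_simp
  -- `|sₙ| e^{−(S+δ)n} ≤ 1`
  have hs1 : |(s n : ℝ)| * Real.exp (-((S + δ) * n)) ≤ 1 := by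
    rw [Real.exp_neg]
    calc |(s n : ℝ)| * (Real.exp ((S + δ) * n))⁻¹
        ≤ Real.exp ((S + δ) * n) * (Real.exp ((S + δ) * n))⁻¹ := by gcongr
      _ = 1 := mul_inv_cancel₀ (Real.exp_pos _).ne'
  -- the integer `A = q rₙ − p sₙ` and the identity `A = q εₙ + sₙ (qα − p)`
  set e : ℝ := (r n : ℝ) - s n * α with he_def
  have hA_eq : ((q * r n - p * s n : ℤ) : ℝ) = q * e + s n * (q * α - p) := by
    push_cast; rw [he_def]; ring
  -- main claim: `|qα − p| ≥ C₀ q^{−λ}`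
  have hmain : C₀ * (q : ℝ) ^ (-lam) ≤ |(q : ℝ) * α - p| := by
    by_cases hA : q * r n - p * s n = 0
    · -- `q rₙ = p sₙ`: `|sₙ||qα − p| = q|εₙ| ≥ q e^{−(R+δ)n}`
      have h0 : (q : ℝ) * e = -((s n : ℝ) * (q * α - p)) := by
        have : ((q * r n - p * s n : ℤ) : ℝ) = 0 := by exact_mod_cast hA
        linarith [hA_eq]
      have h1 : (q : ℝ) * |e| = |(s n : ℝ)| * |(q : ℝ) * α - p| := by
        have := congrArg abs h0
        rwa [abs_mul, abs_neg, abs_mul, abs_of_pos hqpos] at this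
      have h2 : (q : ℝ) * Real.exp (-((R + δ) * n)) ≤ |(s n : ℝ)| * |(q : ℝ) * α - p| := by
        rw [← h1]; gcongr
      have h5 : (q : ℝ) * Real.exp (-((R + δ) * n)) * Real.exp (-((S + δ) * n)) ≤ |(q : ℝ) * α - p| := by
        calc (q : ℝ) * Real.exp (-((R + δ) * n)) * Real.exp (-((S + δ) * n))
            ≤ |(s n : ℝ)| * |(q : ℝ) * α - p| * Real.exp (-((S + δ) * n)) := by gcongr
          _ = |(q : ℝ) * α - p| * (|(s n : ℝ)| * Real.exp (-((S + δ) * n))) := by ring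
          _ ≤ |(q : ℝ) * α - p| * 1 := by gcongr
          _ = |(q : ℝ) * α - p| := mul_one _
      have h6 := key (R + S + 2 * δ) (by linarith)
      have h7 : -((R + S + 2 * δ) / (R - δ)) = -1 + -lam := by
        rw [hlam_def]; field_simp; ring
      have h8 : C₀ * (q : ℝ) ^ (-lam) =
          q * (Real.exp (-(R + S + 2 * δ)) * (2 * (q : ℝ)) ^ (-((R + S + 2 * δ) / (R - δ)))) := by
        rw [h7, hC₀_def, Real.rpow_add h2qpos, Real.rpow_neg_one, Real.mul_rpow (by norm_num) hqpos.le]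
        field_simp
      rw [h8]
      calc (q : ℝ) * (Real.exp (-(R + S + 2 * δ)) * (2 * (q : ℝ)) ^ (-((R + S + 2 * δ) / (R - δ))))
          ≤ q * Real.exp (-((R + S + 2 * δ) * n)) := by gcongr
        _ = q * Real.exp (-((R + δ) * n)) * Real.exp (-((S + δ) * n)) := by
            rw [mul_assoc, ← Real.exp_add]; ring_nf
        _ ≤ |(q : ℝ) * α - p| := h5
    · -- `q rₙ ≠ p sₙ`: `1 ≤ |A| ≤ q|εₙ| + |sₙ||qα − p| ≤ 1/2 + |sₙ||qα − p|`
      have h1 : (1 : ℝ) ≤ |((q * r n - p * s n : ℤ) : ℝ)| := by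
        rw [← Int.cast_abs]; exact_mod_cast Int.one_le_abs hA
      rw [hA_eq] at h1
      have h2 : |(q : ℝ) * e + s n * (q * α - p)| ≤ q * |e| + |(s n : ℝ)| * |(q : ℝ) * α - p| := by
        calc |(q : ℝ) * e + s n * (q * α - p)| ≤ |(q : ℝ) * e| + |(s n : ℝ) * (q * α - p)| := abs_add_le _ _
          _ = q * |e| + |(s n : ℝ)| * |(q : ℝ) * α - p| := by
              rw [abs_mul, abs_mul, abs_of_pos hqpos]
      have h3 : (q : ℝ) * |e| ≤ 1 / 2 := le_trans (by gcongr) hi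
      have h4 : 1 / 2 ≤ |(s n : ℝ)| * |(q : ℝ) * α - p| := by linarith
      have h5 : 1 / 2 * Real.exp (-((S + δ) * n)) ≤ |(q : ℝ) * α - p| := by
        calc 1 / 2 * Real.exp (-((S + δ) * n))
            ≤ |(s n : ℝ)| * |(q : ℝ) * α - p| * Real.exp (-((S + δ) * n)) := by gcongr
          _ = |(q : ℝ) * α - p| * (|(s n : ℝ)| * Real.exp (-((S + δ) * n))) := by ring
          _ ≤ |(q : ℝ) * α - p| * 1 := by gcongr
          _ = |(q : ℝ) * α - p| := mul_one _
      have h6 := key (S + δ) (by linarith)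
      have h7 : C₀ * (q : ℝ) ^ (-lam) ≤
          1 / 2 * (Real.exp (-(S + δ)) * (2 * (q : ℝ)) ^ (-((S + δ) / (R - δ)))) := by
        have ha : Real.exp (-(R + S + 2 * δ)) ≤ Real.exp (-(S + δ)) := Real.exp_le_exp.2 (by linarith)
        have hb : (2 : ℝ) ^ (-lam) * (q : ℝ) ^ (-lam) ≤ (2 * (q : ℝ)) ^ (-((S + δ) / (R - δ))) := by
          rw [← Real.mul_rpow (by norm_num) hqpos.le]
          apply Real.rpow_le_rpow_of_exponent_le h2q.le
          rw [neg_le_neg_iff, hlam_def]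
          exact div_le_div_of_nonneg_right (by linarith) hc.le
        calc C₀ * (q : ℝ) ^ (-lam)
            = 1 / 2 * (Real.exp (-(R + S + 2 * δ)) * ((2 : ℝ) ^ (-lam) * (q : ℝ) ^ (-lam))) := by
              rw [hC₀_def]; ring
          _ ≤ 1 / 2 * (Real.exp (-(S + δ)) * (2 * (q : ℝ)) ^ (-((S + δ) / (R - δ)))) := by gcongr
      linarith [h5, h6, h7]
  -- conclusion: `|α − p/q| = |qα − p|/q ≥ C₀ q^{−λ−1} ≥ q^{−(S/R+1)−ε}`
  have hCq : (q : ℝ) ^ (-(ε / 2)) ≤ C₀ := by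
    have hB1 : C₀ ^ (-(2 / ε)) ≤ (q : ℝ) := by
      have : C₀ ^ (-(2 / ε)) ≤ B := le_max_left _ _
      linarith
    calc (q : ℝ) ^ (-(ε / 2)) ≤ (C₀ ^ (-(2 / ε))) ^ (-(ε / 2)) :=
          Real.rpow_le_rpow_of_nonpos (Real.rpow_pos_of_pos hC₀ _) hB1 (by linarith)
      _ = C₀ := by
          rw [← Real.rpow_mul hC₀.le]
          have : -(2 / ε) * -(ε / 2) = 1 := by field_simp
          rw [this, Real.rpow_one]
  have hκlam : (q : ℝ) ^ (-κ) ≤ (q : ℝ) ^ (-lam) :=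
    Real.rpow_le_rpow_of_exponent_le hq1 (by linarith)
  have hsplit : (q : ℝ) ^ (-(S / R + 1 + ε)) = (q : ℝ) ^ (-(ε / 2)) * (q : ℝ) ^ (-κ) / q := by
    rw [eq_div_iff hqpos.ne', ← Real.rpow_add hqpos, ← Real.rpow_add_one hqpos.ne']
    congr 1; rw [hκ_def]; ring
  have habs : |α - p / q| = |(q : ℝ) * α - p| / q := by
    rw [show α - p / q = ((q : ℝ) * α - p) / q by field_simp, abs_div, abs_of_pos hqpos]
  rw [hsplit, habs]
  calc (q : ℝ) ^ (-(ε / 2)) * (q : ℝ) ^ (-κ) / q ≤ C₀ * (q : ℝ) ^ (-lam) / q := by gcongr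
    _ ≤ |(q : ℝ) * α - p| / q := by gcongr

/-- Two-sided exponential rates from the literal limit `lim (1/n) log|εₙ| = −R` (`R > 0`; in Lean `log 0 = 0`, so
`εₙ ≠ 0` for large `n` is automatic). [cite: RhinViola1996, Lemma 4.3 (p. 51)] -/
theorem rates_of_tendsto_log_neg {R : ℝ} (hR : 0 < R) {e : ℕ → ℝ}
    (h : Tendsto (fun n : ℕ => Real.log |e n| / n) atTop (𝓝 (-R))) :
    ∀ δ : ℝ, 0 < δ → ∀ᶠ n : ℕ in atTop,
      Real.exp (-((R + δ) * n)) ≤ |e n| ∧ |e n| ≤ Real.exp (-((R - δ) * n)) := by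
  intro δ hδ
  set δ' := min δ (R / 2) with hδ'
  have hδ'pos : 0 < δ' := lt_min hδ (by linarith)
  have hδ'le : δ' ≤ δ := min_le_left _ _
  have hδ'R : δ' < R := lt_of_le_of_lt (min_le_right _ _) (by linarith)
  obtain ⟨N, hN⟩ := (Metric.tendsto_atTop.1 h) δ' hδ'pos
  filter_upwards [eventually_ge_atTop (max N 1)] with n hn
  have hnN : N ≤ n := le_trans (le_max_left _ _) hn
  have hn0 : (0 : ℝ) < n := by exact_mod_cast lt_of_lt_of_le Nat.one_pos (le_trans (le_max_right _ _) hn)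
  have hd := hN n hnN
  rw [Real.dist_eq, abs_lt] at hd
  obtain ⟨hd1, hd2⟩ := hd
  -- `εₙ ≠ 0`: otherwise `log|εₙ|/n = 0`, contradicting `|0 + R| < δ' < R`
  have hne : e n ≠ 0 := by
    intro h0
    rw [h0, abs_zero, Real.log_zero, zero_div] at hd2
    linarith
  have hpos : 0 < |e n| := abs_pos.2 hne
  have hlo : (-(R + δ')) * n < Real.log |e n| := by
    have := (lt_div_iff₀ hn0).1 (by linarith : -R - δ' < Real.log |e n| / n); linarith
  have hhi : Real.log |e n| < (-(R - δ')) * n := by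
    have := (div_lt_iff₀ hn0).1 (by linarith : Real.log |e n| / n < -R + δ'); linarith
  constructor
  · calc Real.exp (-((R + δ) * n)) ≤ Real.exp ((-(R + δ')) * n) :=
          Real.exp_le_exp.2 (by nlinarith)
      _ ≤ |e n| := by rw [← Real.exp_log hpos]; exact Real.exp_le_exp.2 hlo.le
  · calc |e n| ≤ Real.exp ((-(R - δ')) * n) := by rw [← Real.exp_log hpos]; exact Real.exp_le_exp.2 hhi.le
      _ ≤ Real.exp (-((R - δ) * n)) := Real.exp_le_exp.2 (by nlinarith)

/-- Exponential upper rate from "`(1/n) log|sₙ| ≤ S + δ` for all large `n`, every `δ > 0`" (= `limsup (1/n) log|sₙ| ≤ S`;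
`S > 0`). [cite: RhinViola1996, Lemma 4.3 (p. 51)] -/
theorem rate_of_log_le {S : ℝ} {s : ℕ → ℤ}
    (h : ∀ δ : ℝ, 0 < δ → ∀ᶠ n : ℕ in atTop, Real.log |(s n : ℝ)| / n ≤ S + δ) :
    ∀ δ : ℝ, 0 < δ → ∀ᶠ n : ℕ in atTop, |(s n : ℝ)| ≤ Real.exp ((S + δ) * n) := by
  intro δ hδ
  filter_upwards [h δ hδ, eventually_ge_atTop 1] with n hn hn1
  have hn0 : (0 : ℝ) < n := by exact_mod_cast hn1
  by_cases h0 : s n = 0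
  · rw [h0]; simp [Real.exp_nonneg]
  · have hpos : 0 < |(s n : ℝ)| := abs_pos.2 (by exact_mod_cast h0)
    have : Real.log |(s n : ℝ)| ≤ (S + δ) * n := by
      have := (div_le_iff₀ hn0).1 hn; linarith
    rw [← Real.exp_log hpos]; exact Real.exp_le_exp.2 this

/-- **Rhin–Viola 1996, Lemma 4.3** (literal form): `α ∈ ℝ`, integer sequences `(rₙ)`, `(sₙ)` with
`lim (1/n) log|rₙ − sₙα| = −R` and `limsup (1/n) log|sₙ| ≤ S` (typed: for every `δ > 0`, `(1/n) log|sₙ| ≤ S + δ` for all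
large `n`), `R, S > 0`. Then `μ(α) ≤ S/R + 1` (`HasIrrationalityMeasure α (S/R + 1)`). [cite: RhinViola1996, Lemma 4.3 (p. 51)] -/
theorem lemma43 {α R S : ℝ} (hR : 0 < R) (hS : 0 < S) (r s : ℕ → ℤ)
    (herr : Tendsto (fun n : ℕ => Real.log |(r n : ℝ) - s n * α| / n) atTop (𝓝 (-R)))
    (hs : ∀ δ : ℝ, 0 < δ → ∀ᶠ n : ℕ in atTop, Real.log |(s n : ℝ)| / n ≤ S + δ) :
    HasIrrationalityMeasure α (S / R + 1) :=
  lemma43_of_rates hR hS r s (rates_of_tendsto_log_neg hR herr) (rate_of_log_le hs)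

/-- **Lemma 4.3 in the `LiouvilleWith` vocabulary** of the tree's record statements: under the hypotheses of `lemma43`,
`α` is not `p`-Liouville for any `p > S/R + 1`. [cite: RhinViola1996, Lemma 4.3 (p. 51)] -/
theorem lemma43_not_liouvilleWith {α R S : ℝ} (hR : 0 < R) (hS : 0 < S) (r s : ℕ → ℤ)
    (herr : Tendsto (fun n : ℕ => Real.log |(r n : ℝ) - s n * α| / n) atTop (𝓝 (-R)))
    (hs : ∀ δ : ℝ, 0 < δ → ∀ᶠ n : ℕ in atTop, Real.log |(s n : ℝ)| / n ≤ S + δ)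
    {p : ℝ} (hp : S / R + 1 < p) : ¬ LiouvilleWith p α :=
  (lemma43 hR hS r s herr hs).not_liouvilleWith hp

/-- In particular `α` is irrational (an exact negative error rate forces `0 < |rₙ − sₙα| → 0`).
[cite: RhinViola1996, Lemma 4.3 (p. 51) with p. 23 ("irrationality measure of the irrational number `α`")] -/
theorem irrational_of_rates {α R : ℝ} (hR : 0 < R) (r s : ℕ → ℤ)
    (herr : Tendsto (fun n : ℕ => Real.log |(r n : ℝ) - s n * α| / n) atTop (𝓝 (-R))) : Irrational α := by
  rintro ⟨x, rfl⟩
  have hrate := rates_of_tendsto_log_neg hR herr (R / 2) (by positivity)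
  -- `|rₙ − sₙ x| ≥ 1/den x` whenever non-zero; but it tends to `0` while staying positive
  have hev : ∀ᶠ n : ℕ in atTop, Real.exp (-((R - R / 2) * n)) < 1 / (x.den : ℝ) := by
    have ht : Tendsto (fun n : ℕ => Real.exp (-((R - R / 2) * n))) atTop (𝓝 0) := by
      have : Tendsto (fun n : ℕ => -((R - R / 2) * (n : ℝ))) atTop atBot := by
        have h1 : Tendsto (fun n : ℕ => (R - R / 2) * (n : ℝ)) atTop atTop :=
          Tendsto.const_mul_atTop (by linarith) tendsto_natCast_atTop_atTop
        exact tendsto_neg_atTop_atBot.comp h1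
      exact Real.tendsto_exp_atBot.comp this
    exact ht.eventually (gt_mem_nhds (by positivity))
  obtain ⟨n, ⟨hlo, hhi⟩, hlt⟩ := (hrate.and hev).exists
  have hden : (0 : ℝ) < x.den := by exact_mod_cast x.den_pos
  have hxd : (x : ℝ) * x.den = x.num := by exact_mod_cast Rat.mul_den_eq_num x
  have hm : ((r n : ℝ) - s n * (x : ℝ)) * x.den = ((r n * x.den - s n * x.num : ℤ) : ℝ) := by
    push_cast; rw [sub_mul, mul_assoc, hxd]
  -- the integer `rₙ den(x) − sₙ num(x)` is non-zero (lower rate), hence `|rₙ − sₙx| ≥ 1/den(x)`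
  have hne : (r n * x.den - s n * x.num : ℤ) ≠ 0 := by
    intro h0
    have h1 : ((r n : ℝ) - s n * (x : ℝ)) * x.den = 0 := by rw [hm]; exact_mod_cast h0
    rcases mul_eq_zero.1 h1 with h | h
    · rw [h, abs_zero] at hlo; linarith [Real.exp_pos (-((R + R / 2) * n))]
    · linarith
  have hge : 1 / (x.den : ℝ) ≤ |(r n : ℝ) - s n * (x : ℝ)| := by
    rw [div_le_iff₀ hden, ← abs_of_pos hden, ← abs_mul, hm, ← Int.cast_abs]
    exact_mod_cast Int.one_le_abs hne
  linarith

end Literature.NumberTheory.Irrationality.RhinViola1996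

end
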